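import Literature.MathematicalPhysics.QuantumLattice.AbelianMagneticFlux
import HarnessLib

/-!
# The lattice Bianchi identity and the flux sectors of admissible abelian fields

Continuation of `AbelianFieldTensor.lean` / `AbelianMagneticFlux.lean` (Lüscher's abelian field
tensor `F_{μν} = (1/i) ln P ∈ (−π, π]` and the magnetic flux `φ_{μν}(x) = Σ_plane F_{μν}`).

* `plaquetteHolonomy_cube` — **the cube identity** for an abelian gauge group: the six oriented
  plaquettes of an elementary cube multiply to `1` (every edge occurs once with each
  orientation); `plaquetteHolonomy_swap_eq_inv` — `P(x,ν,μ) = P(x,μ,ν)⁻¹`.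
* `abelianFieldTensor_bianchi` — **the lattice Bianchi identity**
  `∂_ν F_{ρσ} + ∂_ρ F_{σν} + ∂_σ F_{νρ} = 0` (forward differences) for fields with
  `|F_{μν}| < π/3` on the lattice: the left side is `≡ 0 (mod 2π)` by the cube identity and
  `< 6 · π/3 = 2π` in absolute value [Luscher1999AbelianChiral, §2.2, the remark after (2.11):
  "a consequence of the Bianchi identity ... which holds for admissible fields with `ε < π/3`";
  Luscher1999AbelianTopology, §3]; `abelianFieldTensor_swap` — `F_{νμ} = −F_{μν}` off the cut.
* `magneticFlux_shift`, `magneticFlux_eq_of_admissible` — **the magnetic flux of an admissible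
  field does not depend on the base point**: `φ_{μν}(x) = φ_{μν}(y)` for all `x, y` when
  `|F| < π/3` everywhere, completing Lüscher's (2.11) (`φ_{μν} = 2π m_{μν}` with a well-defined
  antisymmetric integer tensor `m`, the flux sector of the field; the quantisation
  `φ ∈ 2πℤ` is `exists_int_magneticFlux_eq`).

Theorems only; no definitions, no named facts.

## References

* M. Lüscher, *Abelian chiral gauge theories on the lattice with exact gauge invariance*,
  Nucl. Phys. B 549 (1999) 295–334, arXiv:hep-lat/9811032, §2.1–2.2, eqs. (2.10)–(2.11).
  [Luscher1999AbelianChiral]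
* M. Lüscher, *Topology and the axial anomaly in abelian lattice gauge theories*,
  Nucl. Phys. B 538 (1999) 515–529, arXiv:hep-lat/9808021, §3. [Luscher1999AbelianTopology]
-/

noncomputable section

open Finset
open Literature.Probability.LatticeModels (TorusSite)
open Literature.MathematicalPhysics.QuantumFieldTheory

namespace Literature.MathematicalPhysics.QuantumLattice

/-! ### The lattice Bianchi identity and the position-independence of the flux -/

section Bianchi

variable {d L : ℕ}

/-- **The cube identity** (abelian gauge group): around an elementary cube the six oriented
plaquettes multiply to `1` — every edge of the cube occurs once with each orientation. This is the
multiplicative form of the lattice Bianchi identity `ε_{μνρσ} ∂_ν F_{ρσ} = 0 (mod 2π)`.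
[cite: Luscher1999AbelianChiral, §2.1; Luscher1999AbelianTopology, §3] -/
theorem plaquetteHolonomy_cube {G : Type*} [CommGroup G] (U : GaugeConfig d L G) (x : TorusSite d L)
    (ν ρ σ : Fin d) :
    plaquetteHolonomy U (Site.shift x ν) ρ σ * (plaquetteHolonomy U x ρ σ)⁻¹ *
      (plaquetteHolonomy U (Site.shift x ρ) σ ν * (plaquetteHolonomy U x σ ν)⁻¹) *
      (plaquetteHolonomy U (Site.shift x σ) ν ρ * (plaquetteHolonomy U x ν ρ)⁻¹) = 1 := by
  simp only [plaquetteHolonomy, Site.shift, add_comm, add_left_comm]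
  rw [← ofMul_eq_zero]
  simp only [ofMul_mul, ofMul_inv]
  abel

/-- **Lattice Bianchi identity** for the abelian field tensor: if `|F| < π/3` on the six
plaquettes of the cube at `x` spanned by `ν, ρ, σ`, then
`∂_ν F_{ρσ}(x) + ∂_ρ F_{σν}(x) + ∂_σ F_{νρ}(x) = 0` (`∂_ν f(x) = f(x+ν̂) − f(x)`): by the cube
identity the left side is a multiple of `2π`, and it is `< 2π` in absolute value.
[cite: Luscher1999AbelianChiral, §2.2 (the remark after (2.11)); Luscher1999AbelianTopology, §3] -/
theorem abelianFieldTensor_bianchi (U : GaugeConfig d L Circle) (x : TorusSite d L) (ν ρ σ : Fin d)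
    (hF : ∀ (y : TorusSite d L) (α β : Fin d), |abelianFieldTensor U y α β| < Real.pi / 3) :
    abelianFieldTensor U (Site.shift x ν) ρ σ - abelianFieldTensor U x ρ σ +
      (abelianFieldTensor U (Site.shift x ρ) σ ν - abelianFieldTensor U x σ ν) +
      (abelianFieldTensor U (Site.shift x σ) ν ρ - abelianFieldTensor U x ν ρ) = 0 := by
  set S := abelianFieldTensor U (Site.shift x ν) ρ σ - abelianFieldTensor U x ρ σ +
      (abelianFieldTensor U (Site.shift x ρ) σ ν - abelianFieldTensor U x σ ν) +
      (abelianFieldTensor U (Site.shift x σ) ν ρ - abelianFieldTensor U x ν ρ) with hS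
  have hexp : Circle.exp S = 1 := by
    simp only [hS, Circle.exp_add, Circle.exp_sub, exp_abelianFieldTensor, div_eq_mul_inv]
    exact plaquetteHolonomy_cube U x ν ρ σ
  obtain ⟨n, hn⟩ := Circle.exp_eq_one.mp hexp
  have hbound : |S| < 2 * Real.pi := by
    have h1 := hF (Site.shift x ν) ρ σ
    have h2 := hF x ρ σ
    have h3 := hF (Site.shift x ρ) σ ν
    have h4 := hF x σ ν
    have h5 := hF (Site.shift x σ) ν ρ
    have h6 := hF x ν ρ
    rw [abs_lt] at h1 h2 h3 h4 h5 h6 ⊢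
    constructor <;> linarith
  -- an integer multiple of `2π` of absolute value `< 2π` vanishes
  have hn0 : n = 0 := by
    rw [hn, abs_lt] at hbound
    have hπ := Real.pi_pos
    have h1 : (n : ℝ) < 1 := by nlinarith
    have h2 : (-1 : ℝ) < n := by nlinarith
    have h1' : n < 1 := by exact_mod_cast h1
    have h2' : -1 < n := by exact_mod_cast h2
    omega
  rw [hn, hn0, Int.cast_zero, zero_mul]

/-- `P(x,ν,μ) = P(x,μ,ν)⁻¹` (abelian gauge group). [folklore] -/
theorem plaquetteHolonomy_swap_eq_inv {G : Type*} [CommGroup G] (U : GaugeConfig d L G)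
    (x : TorusSite d L) (μ ν : Fin d) :
    plaquetteHolonomy U x ν μ = (plaquetteHolonomy U x μ ν)⁻¹ := by
  simp only [plaquetteHolonomy]
  rw [eq_inv_iff_mul_eq_one, ← ofMul_eq_zero]
  simp only [ofMul_mul, ofMul_inv]
  abel

/-- Antisymmetry of the field tensor away from the cut: `F_{νμ}(x) = −F_{μν}(x)` whenever
`F_{μν}(x) ≠ π` (in particular for admissible fields). [cite: Luscher1999AbelianTopology, §3 (3.4)] -/
theorem abelianFieldTensor_swap (U : GaugeConfig d L Circle) (x : TorusSite d L) (μ ν : Fin d)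
    (h : abelianFieldTensor U x μ ν ≠ Real.pi) :
    abelianFieldTensor U x ν μ = -abelianFieldTensor U x μ ν := by
  unfold abelianFieldTensor at h ⊢
  rw [plaquetteHolonomy_swap_eq_inv U x μ ν, Circle.coe_inv, Complex.arg_inv, if_neg h]

/-! ### Position-independence of the magnetic flux for admissible fields -/

variable [NeZero L]

/-- **The flux does not depend on the base point, one step**: for a field with `|F| < π/3`
everywhere, `φ_{μν}(x + ρ̂) = φ_{μν}(x)` for every direction `ρ` — the difference is the plane sum
of `∂_ρ F_{μν}`, which by the Bianchi identity is minus the plane sum of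
`∂_μ F_{νρ} + ∂_ν F_{ρμ}`, and in-plane differences sum to zero around the torus.
[cite: Luscher1999AbelianChiral, §2.2, eq. (2.11)] -/
theorem magneticFlux_shift (U : GaugeConfig d L Circle)
    (hF : ∀ (y : TorusSite d L) (α β : Fin d), |abelianFieldTensor U y α β| < Real.pi / 3)
    (x : TorusSite d L) (μ ν ρ : Fin d) :
    magneticFlux U (Site.shift x ρ) μ ν = magneticFlux U x μ ν := by
  rw [← sub_eq_zero, magneticFlux, magneticFlux, ← Finset.sum_sub_distrib]
  simp_rw [← Finset.sum_sub_distrib]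
  have hy : ∀ s t : ZMod L, Site.shift x ρ + Pi.single μ s + Pi.single ν t =
      Site.shift (x + Pi.single μ s + Pi.single ν t) ρ := by
    intro s t
    simp only [Site.shift]
    abel
  simp_rw [hy]
  have key : ∀ s t : ZMod L,
      abelianFieldTensor U (Site.shift (x + Pi.single μ s + Pi.single ν t) ρ) μ ν -
          abelianFieldTensor U (x + Pi.single μ s + Pi.single ν t) μ ν =
        -(abelianFieldTensor U (x + Pi.single μ (s + 1) + Pi.single ν t) ν ρ -
            abelianFieldTensor U (x + Pi.single μ s + Pi.single ν t) ν ρ) -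
          (abelianFieldTensor U (x + Pi.single μ s + Pi.single ν (t + 1)) ρ μ -
            abelianFieldTensor U (x + Pi.single μ s + Pi.single ν t) ρ μ) := by
    intro s t
    have h := abelianFieldTensor_bianchi U (x + Pi.single μ s + Pi.single ν t) ρ μ ν hF
    rw [plane_shift_mu, plane_shift_nu] at h
    linarith
  simp_rw [key]
  simp only [Finset.sum_sub_distrib, Finset.sum_neg_distrib]
  have hA : ∑ s : ZMod L, ∑ t : ZMod L,
        abelianFieldTensor U (x + Pi.single μ (s + 1) + Pi.single ν t) ν ρ =
      ∑ s : ZMod L, ∑ t : ZMod L, abelianFieldTensor U (x + Pi.single μ s + Pi.single ν t) ν ρ :=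
    Fintype.sum_equiv (Equiv.addRight (1 : ZMod L)) _ _ fun s => by
      simp only [Equiv.coe_addRight]
  have hB : ∑ s : ZMod L, ∑ t : ZMod L,
        abelianFieldTensor U (x + Pi.single μ s + Pi.single ν (t + 1)) ρ μ =
      ∑ s : ZMod L, ∑ t : ZMod L, abelianFieldTensor U (x + Pi.single μ s + Pi.single ν t) ρ μ :=
    Finset.sum_congr rfl fun s _ =>
      Fintype.sum_equiv (Equiv.addRight (1 : ZMod L)) _ _ fun t => by
        simp only [Equiv.coe_addRight]
  linarith [hA, hB]

/-- Iterating `magneticFlux_shift`: `φ_{μν}(x + n ρ̂) = φ_{μν}(x)`. [cite: Luscher1999AbelianChiral, §2.2, eq. (2.11)] -/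
theorem magneticFlux_add_single_nat (U : GaugeConfig d L Circle)
    (hF : ∀ (y : TorusSite d L) (α β : Fin d), |abelianFieldTensor U y α β| < Real.pi / 3)
    (μ ν ρ : Fin d) : ∀ (n : ℕ) (x : TorusSite d L),
      magneticFlux U (x + Pi.single ρ (n : ZMod L)) μ ν = magneticFlux U x μ ν := by
  intro n
  induction n with
  | zero => intro x; simp
  | succ n ih =>
    intro x
    have : x + Pi.single ρ ((n + 1 : ℕ) : ZMod L) = Site.shift (x + Pi.single ρ (n : ZMod L)) ρ := by
      rw [Site.shift, Nat.cast_succ, Pi.single_add, add_assoc]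
    rw [this, magneticFlux_shift U hF, ih]

/-- **The magnetic flux of an admissible field is independent of the base point**: for a `U(1)`
field on the periodic lattice with `|F_{μν}| < π/3` everywhere, `φ_{μν}(x) = φ_{μν}(y)` for all
`x, y` — so the flux quantum `m_{μν}` of `exists_int_magneticFlux_eq` is a well-defined integer
tensor of the field (its flux sector), Lüscher's (2.11). [cite: Luscher1999AbelianChiral, §2.2, eq. (2.11)] -/
theorem magneticFlux_eq_of_admissible (U : GaugeConfig d L Circle)
    (hF : ∀ (y : TorusSite d L) (α β : Fin d), |abelianFieldTensor U y α β| < Real.pi / 3)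
    (x y : TorusSite d L) (μ ν : Fin d) : magneticFlux U x μ ν = magneticFlux U y μ ν := by
  -- write `x = y + Σ_ρ (x − y)_ρ ρ̂` and peel off one direction at a time
  have hxy : x = y + ∑ ρ : Fin d, Pi.single ρ ((x - y) ρ) := by
    rw [Finset.univ_sum_single]
    abel
  suffices h : ∀ (S : Finset (Fin d)) (z : TorusSite d L),
      magneticFlux U (z + ∑ ρ ∈ S, Pi.single ρ ((x - y) ρ)) μ ν = magneticFlux U z μ ν by
    rw [hxy]
    exact h Finset.univ y
  intro S
  induction S using Finset.induction_on with
  | empty => intro z; simp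
  | insert a S ha ih =>
    intro z
    have ih' : magneticFlux U (z + Pi.single a ((x - y) a) + ∑ ρ ∈ S, Pi.single ρ ((x - y) ρ)) μ ν =
        magneticFlux U (z + Pi.single a ((x - y) a)) μ ν := ih _
    rw [Finset.sum_insert ha, ← add_assoc, ih', ← ZMod.natCast_zmod_val ((x - y) a),
      magneticFlux_add_single_nat U hF μ ν a]

end Bianchi

end Literature.MathematicalPhysics.QuantumLattice
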